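import Summits.QuantumFields.BalabanUV.Beta.GAN24.DirichletVertexDom

/-!
# `BalabanUV.Beta.GAN24.DirichletVertexDomSum` — binder row G-an2-4 / (CONV-C), road P2 PART IV, leaf L14 (the torus transfer), FILE C5b-3:
# THE SUMMED WEIGHTED INTERIOR HESSIAN ON A UNION OF UNIT BLOCKS — binder (A′)/(A_ω) in FIELD FORM and for the zero-extended Dirichlet
# solution of ANY decidable spelling of the block region (unit b2b-balaban-gan24-p2, gen 27, v1)

HONEST FRAMING (cell contract, verbatim): «discharging `BetaPertH` makes Bałaban's UV stability UNCONDITIONAL — a real constructive-QFT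
result; it is NOT the continuum limit and NOT the Clay problem.»  SUPPLIER module under the T⁴-DAG sub-row `T4-U1a.S-NE2-D1-DIRICHLET°`
(owner wording R24 «the full rate L⁻¹ beyond boxes OPEN»).  From the pointwise domination `DirichletVertexDom.dom_pointwise` (p246751) and the
per-window bounds (p244740 dyadic, p246354 product windows, p245486 pieces): for `d = 2`, `Ω = blockReg n M S` ANY union of unit blocks,
`n ≥ 64`, `M_ν ≥ 2`, a family `V` of re-entrant vertices containing all of them, and a weight `g` as in p246751,
`Σ_μ Σ_{x∈Ω} g(x)|(∂ᴴ_μ∂_μ u)(x)|² ≤ C_g|V|·(2C_J·E + C′_J·B) + g_max·20|Tor M|·(2B + 32(n/L)²E + 16(n/L)⁴‖u‖²)` for EVERY `u` vanishing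
off `Ω` (`E = ‖∂₀u‖² + ‖∂₁u‖²`, `B = Σ_Ω|Δu|²`), and hence `≤ α_dom·‖f‖²` for `u = solExt_p f`, ANY decidable `p ↔ blockReg n M S` (the
socket's fine region is spelled `refineR`).  `n/L ≤ 128`.

## Contents ([folklore]; 0 sorry)
* §1 exchange/counting lemmas; the per-family bounds `sum_WH_le`, `sum_WP_le`, `sum_WT_le`, `sum_WI_le` (field form).
* §2 **`dom_sum_field`**; §3 the constants `cU`, `alphaDom`, `nL_le_128`, and **`dom_sum_solExt`** (generic predicate).

ABSOLUTE RULE (cell, verbatim): «No internally-minted statement may enter as a cited fact. Every hypothesis is either kernel-proved in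
this package or a verbatim quotation of a PUBLISHED theorem with page reference. The manuscript(s) under audit are NOT citable for
their own disputed steps — they are the thing under adjudication; programme-internal (2001/route/tribunal) claims are never citable.»
Nothing printed is a hypothesis.  NOT CLAIMED: (Φ)/(Φ′), the END (p234489 stays CONDITIONAL); constants carry `|V|`, `|Tor M|` and
`10⁹/(γ−1)` (not optimised); NOT NE2, (CONV-C), `BetaPertH`, continuum, Clay.  «not in print; our proof attempt».  HONEST DEPENDENCY: continuum
YM on T⁴ ⇐ BetaPertH ∧ nine spine estimates (0/9 proved); BetaPertH ⇐ (D1) ∧ (D4) ∧ CAP+tail; G-an2-4 gates asym, D1 and NE2/3/4.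
-/

noncomputable section

open scoped BigOperators ComplexConjugate Matrix
open Finset

namespace Summit.QuantumFields.BalabanUV.Beta.GAN24.DirichletVertexDomSum

open Literature.MathematicalPhysics.QuantumFieldTheory.Balaban1983to89.B5Prop11Plancherel (Tor fine unitVec)
open Literature.MathematicalPhysics.QuantumFieldTheory.Balaban1983to89.B5Action121 (sdiff LapS)
open Literature.MathematicalPhysics.QuantumFieldTheory.Balaban1983to89.B5Prop11Lower (nsq nsq_nonneg)
open Summit.QuantumFields.BalabanUV.T4Continuum.ScalarAveragedPropagator (gammaPs gammaPs_pos dirichlet)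
open Summit.QuantumFields.BalabanUV.Beta.GAN24.DirichletBoxRegularity (Pdir)
open Summit.QuantumFields.BalabanUV.Beta.GAN24.DirichletBoxTrace (blockReg)
open Summit.QuantumFields.BalabanUV.Beta.GAN24.DirichletBoxCompression (solExt solExt_apply_of_not dirichlet_solExt_le
  sum_normSq_LapS_solExt_le nsq_solExt_le)
open DirichletRingCutoff (tIdx)
open DirichletRingHessianWindow (rho)
open DirichletVertexChart
open DirichletVertexHessian (hessW hessW_nonneg alphaV vertex_weighted_hessian_le)
open DirichletVertexLocalT (WprodT plainWT plainWT_nonneg)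
open DirichletVertexPiece (IsolatedAt pieceW pieceW_nonneg piece_hessian_le)
open DirichletVertexLocate (TT IsProdAt)
open DirichletVertexLocalW (Awin Bwin hW_corner hW_both hW_fst hW_snd vertexT_plain_hessian_le')
open DirichletVertexDom

variable (n : ℕ) [NeZero n] (M : Fin 2 → ℕ) [hM : ∀ μ, NeZero (M μ)] (S : Tor M → Prop) [DecidablePred S]

/-! ## §1 Exchange, counting, and the per-family bounds -/

omit [DecidablePred S] in
/-- exchange of the family sum with the site/direction sums, and counting: if every member is bounded by `c`, the family is bounded by
`|I|·c`. [folklore] -/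
theorem sum_family_le {ι : Type*} (I : Finset ι) (W : ι → Tor (fine n M) → ℝ) (F : Fin 2 → Tor (fine n M) → ℝ) {c : ℝ}
    (h : ∀ i ∈ I, ∑ μ, ∑ x, W i x * F μ x ≤ c) :
    ∑ μ, ∑ x, (∑ i ∈ I, W i x) * F μ x ≤ I.card * c := by
  have e : ∑ μ, ∑ x, (∑ i ∈ I, W i x) * F μ x = ∑ i ∈ I, ∑ μ, ∑ x, W i x * F μ x := by
    calc ∑ μ, ∑ x, (∑ i ∈ I, W i x) * F μ x = ∑ μ, ∑ x, ∑ i ∈ I, W i x * F μ x := by simp only [sum_mul]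
      _ = ∑ μ, ∑ i ∈ I, ∑ x, W i x * F μ x := sum_congr rfl fun μ _ => sum_comm
      _ = _ := sum_comm
  rw [e]
  have := Finset.sum_le_card_nsmul I (fun i => ∑ μ, ∑ x, W i x * F μ x) c h
  rwa [nsmul_eq_mul] at this

section Field

variable {u : Tor (fine n M) → ℂ}

/-- the energy `E = ‖∂₀u‖² + ‖∂₁u‖²`. [folklore] -/
def En (u : Tor (fine n M) → ℂ) : ℝ := nsq (sdiff (fine n M) (n : ℂ) 0 *ᵥ u) + nsq (sdiff (fine n M) (n : ℂ) 1 *ᵥ u)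

/-- the Laplacian budget `B = Σ_{x∈Ω}|Δu(x)|²`. [folklore] -/
def Bn (S : Tor M → Prop) [DecidablePred S] (u : Tor (fine n M) → ℂ) : ℝ :=
  ∑ x ∈ univ.filter (blockReg n M S), ‖(LapS (fine n M) (n : ℂ) *ᵥ u) x‖ ^ 2

/-- the unweighted window currency `2B + 32(n/L)²E + 16(n/L)⁴‖u‖²`. [folklore] -/
def cWin (S : Tor M → Prop) [DecidablePred S] (u : Tor (fine n M) → ℂ) : ℝ :=
  2 * Bn n M S u + 32 * ((n : ℝ) / Ln n) ^ 2 * En n M u + 16 * ((n : ℝ) / Ln n) ^ 4 * nsq u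

/-- `0 ≤ E`. [folklore] -/
theorem En_nonneg (u : Tor (fine n M) → ℂ) : 0 ≤ En n M u := add_nonneg (nsq_nonneg _) (nsq_nonneg _)

/-- `0 ≤ B`. [folklore] -/
theorem Bn_nonneg (u : Tor (fine n M) → ℂ) : 0 ≤ Bn n M S u := sum_nonneg fun _ _ => sq_nonneg _

/-- `0 ≤ cWin`. [folklore] -/
theorem cWin_nonneg (u : Tor (fine n M) → ℂ) : 0 ≤ cWin n M S u := by
  have := En_nonneg n M u; have := Bn_nonneg n M S u; have := nsq_nonneg u
  unfold cWin; positivity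

/-- **the dyadic family**: `Σ_μ Σ_x W_H·|∂ᴴ∂u|² ≤ |V|·(2C_J·E + C′_J·B)`. [folklore] -/
theorem sum_WH_le (V : Finset ((Fin 2 → Bool) × Tor M)) (hV : ∀ v ∈ V, ReentrantAt M S v.1 v.2)
    (hu : ∀ x, ¬ blockReg n M S x → u x = 0) (hn : 2 ≤ n) (hM0 : 2 ≤ M 0) (hM1 : 2 ≤ M 1) {J : ℕ} (hJ : 20 * 2 ^ J + 1 ≤ n - 1)
    {ε : ℝ} (hε : 0 < ε) (hγ : 1 < Real.pi / 3 * (1 - ε / 2)) :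
    ∑ μ, ∑ x, WH n M V J x * ‖(Pdir (fine n M) (n : ℂ) μ *ᵥ u) x‖ ^ 2
      ≤ V.card * (2 * (112 + 10 ^ 9 / (Real.pi / 3 * (1 - ε / 2) - 1)) * En n M u
        + (8 / 5 + 4 * Real.pi * (112 + 10 ^ 9 / (Real.pi / 3 * (1 - ε / 2) - 1)) / (ε * (2 - Real.pi / 3 * (1 - ε / 2)))) * Bn n M S u) := by
  unfold WH
  exact sum_family_le n M V (fun v x => hessW n M v (n - 1) J x) (fun μ x => ‖(Pdir (fine n M) (n : ℂ) μ *ᵥ u) x‖ ^ 2)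
    fun v hv => vertex_weighted_hessian_le n M (σ := v.1) (b := v.2) hu (hV v hv) hn hM0 hM1 hJ hε hγ

/-- **the corner product windows**: `Σ_μ Σ_x W_P·|∂ᴴ∂u|² ≤ |Tor M|·cWin` (`n ≥ 64`). [folklore] -/
theorem sum_WP_le (hu : ∀ x, ¬ blockReg n M S x → u x = 0) (hn : 64 ≤ n) (hM0 : 2 ≤ M 0) (hM1 : 2 ≤ M 1) :
    ∑ μ, ∑ x, WP n M S x * ‖(Pdir (fine n M) (n : ℂ) μ *ᵥ u) x‖ ^ 2 ≤ Fintype.card (Tor M) * cWin n M S u := by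
  obtain ⟨hK, -, hL1, -, -, h4q, -⟩ := census_arith n hn
  unfold WP
  refine (sum_family_le n M _ (fun b x => plainWT n M (TT, b) (Awin M S b 0 0) (Bwin M S b 0 0) 0 0 (Pn n) x)
    (fun μ x => ‖(Pdir (fine n M) (n : ℂ) μ *ᵥ u) x‖ ^ 2) (c := cWin n M S u) fun b hb => ?_).trans ?_
  · have hprod : IsProdAt M S b := (mem_filter.mp hb).2
    have h := vertexT_plain_hessian_le' n M (S := S) (σ := TT) (b := b) (τ₀ := 0) (τ₁ := 0) hu hL1 (c := cn n) (by omega)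
      (hW_corner n M (S := S) hprod (K := 4 * Ln n + cn n + 1) (by omega)) hM0 hM1
    exact h
  · exact mul_le_mul_of_nonneg_right (by exact_mod_cast card_le_univ _) (cWin_nonneg n M S u)

omit [NeZero n] hM [DecidablePred S] in
/-- `|Kgrid| = 15`. [folklore] -/
theorem card_Kgrid : (Kgrid : Finset (ℕ × ℕ)).card = 15 := by decide

/-- **the translated windows**: `Σ_μ Σ_x W_T·|∂ᴴ∂u|² ≤ 15|Tor M|·cWin` (`n ≥ 64`). [folklore] -/
theorem sum_WT_le (hu : ∀ x, ¬ blockReg n M S x → u x = 0) (hn : 64 ≤ n) (hM0 : 2 ≤ M 0) (hM1 : 2 ≤ M 1) :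
    ∑ μ, ∑ x, WT n M S x * ‖(Pdir (fine n M) (n : ℂ) μ *ᵥ u) x‖ ^ 2 ≤ Fintype.card (Tor M) * (15 * cWin n M S u) := by
  obtain ⟨hK, -, hL1, -, -, h4q, -⟩ := census_arith n hn
  have hc0 := cWin_nonneg n M S u
  unfold WT
  refine (sum_family_le n M _ (fun b x => ∑ k ∈ Kgrid, plainWT n M (TT, b) (Awin M S b k.1 k.2) (Bwin M S b k.1 k.2)
      (((n / 4 : ℕ) : ℤ) * k.1) (((n / 4 : ℕ) : ℤ) * k.2) (Pn n) x)
    (fun μ x => ‖(Pdir (fine n M) (n : ℂ) μ *ᵥ u) x‖ ^ 2) (c := 15 * cWin n M S u) fun b _ => ?_).trans (le_of_eq ?_)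
  · rw [show (15 : ℝ) = ((Kgrid : Finset (ℕ × ℕ)).card : ℝ) by rw [card_Kgrid]; norm_num]
    refine sum_family_le n M Kgrid (fun k x => plainWT n M (TT, b) (Awin M S b k.1 k.2) (Bwin M S b k.1 k.2)
      (((n / 4 : ℕ) : ℤ) * k.1) (((n / 4 : ℕ) : ℤ) * k.2) (Pn n) x) _ fun k hk => ?_
    obtain ⟨hk0, hk⟩ := mem_erase.mp hk
    obtain ⟨hk1, hk2⟩ := mem_product.mp hk
    rw [mem_range] at hk1 hk2
    have hq0 : (0 : ℤ) ≤ ((n / 4 : ℕ) : ℤ) := by positivity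
    have hK' : ((4 * Ln n + cn n + 1 : ℕ) : ℤ) + 1 = ((n / 4 : ℕ) : ℤ) := by exact_mod_cast hK
    have h4q' : 4 * ((n / 4 : ℕ) : ℤ) ≤ n := by exact_mod_cast h4q
    have hlow : ∀ j : ℕ, j ≠ 0 → ((4 * Ln n + cn n + 1 : ℕ) : ℤ) ≤ ((n / 4 : ℕ) : ℤ) * j := fun j hj => by
      have h := mul_le_mul_of_nonneg_left (show (1 : ℤ) ≤ j by exact_mod_cast Nat.pos_of_ne_zero hj) hq0
      linarith
    have hhigh : ∀ j : ℕ, j < 4 → ((n / 4 : ℕ) : ℤ) * j + (4 * Ln n + cn n + 1 : ℕ) ≤ n := fun j hj => by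
      have h := mul_le_mul_of_nonneg_left (show (j : ℤ) ≤ 3 by exact_mod_cast Nat.lt_succ_iff.mp hj) hq0
      linarith
    have hW : ∀ i j : ℤ, tIdx i ≤ (4 * Ln n + cn n + 1 : ℕ) → tIdx j ≤ (4 * Ln n + cn n + 1 : ℕ) →
        (blockReg n M S (emb n M TT b (i + ((n / 4 : ℕ) : ℤ) * k.1) (j + ((n / 4 : ℕ) : ℤ) * k.2))
          ↔ WprodT (Awin M S b k.1 k.2) (Bwin M S b k.1 k.2) (((n / 4 : ℕ) : ℤ) * k.1) (((n / 4 : ℕ) : ℤ) * k.2) i j) := by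
      obtain ⟨k₀, k₁⟩ := k
      simp only at hk0 hk1 hk2 ⊢
      by_cases h0 : k₀ = 0
      · subst h0
        have h1 : k₁ ≠ 0 := fun h1 => hk0 (by rw [h1])
        have e0 : ((n / 4 : ℕ) : ℤ) * ((0 : ℕ) : ℤ) = 0 := by simp
        rw [e0]
        exact hW_fst n M (S := S) (b := b) h1 (by omega) (hlow k₁ h1) (hhigh k₁ hk2)
      · by_cases h1 : k₁ = 0
        · subst h1
          have e1 : ((n / 4 : ℕ) : ℤ) * ((0 : ℕ) : ℤ) = 0 := by simp
          rw [e1]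
          exact hW_snd n M (S := S) (b := b) h0 (by omega) (hlow k₀ h0) (hhigh k₀ hk1)
        · exact hW_both n M (S := S) (b := b) h0 h1 (hlow k₀ h0) (hhigh k₀ hk1) (hlow k₁ h1) (hhigh k₁ hk2)
    exact vertexT_plain_hessian_le' n M (S := S) (σ := TT) (b := b) hu hL1 (c := cn n) (by omega) hW hM0 hM1
  · rw [Finset.card_univ]

/-- **the isolated pieces**: `Σ_μ Σ_x W_I·|∂ᴴ∂u|² ≤ 4|Tor M|·cWin` (`n ≥ 64`). [folklore] -/
theorem sum_WI_le (hu : ∀ x, ¬ blockReg n M S x → u x = 0) (hn : 64 ≤ n) (hM0 : 2 ≤ M 0) (hM1 : 2 ≤ M 1) :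
    ∑ μ, ∑ x, WI n M S x * ‖(Pdir (fine n M) (n : ℂ) μ *ᵥ u) x‖ ^ 2 ≤ Fintype.card (Tor M) * (4 * cWin n M S u) := by
  obtain ⟨hK, -, hL1, -, -, h4q, -⟩ := census_arith n hn
  have hc0 := cWin_nonneg n M S u
  have hPn : Pn n = 2 * Ln n + cn n - 1 := rfl
  have hb : ∀ b : Tor M, ∑ μ, ∑ x, (∑ ay ∈ (univ : Finset (Bool × Bool)).filter (fun ay => IsolatedAt M S TT b ay.1 ay.2),
      pieceW n M (TT, b) ay.1 ay.2 (2 * Ln n + cn n - 1) x) * ‖(Pdir (fine n M) (n : ℂ) μ *ᵥ u) x‖ ^ 2 ≤ 4 * cWin n M S u := by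
    intro b
    refine (sum_family_le n M ((univ : Finset (Bool × Bool)).filter (fun ay => IsolatedAt M S TT b ay.1 ay.2))
      (fun ay x => pieceW n M (TT, b) ay.1 ay.2 (2 * Ln n + cn n - 1) x) (fun μ x => ‖(Pdir (fine n M) (n : ℂ) μ *ᵥ u) x‖ ^ 2)
      (c := cWin n M S u) fun ay hay => ?_).trans ?_
    · exact piece_hessian_le n M (S := S) (σ := TT) (b := b) (a := ay.1) (y := ay.2) hu (mem_filter.mp hay).2 hL1 (c := cn n)
        (by omega) hM0 hM1
    · refine mul_le_mul_of_nonneg_right ?_ hc0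
      have h := card_le_univ ((univ : Finset (Bool × Bool)).filter (fun ay => IsolatedAt M S TT b ay.1 ay.2))
      simp only [Fintype.card_prod, Fintype.card_bool] at h
      exact_mod_cast h
  unfold WI
  rw [hPn]
  refine (sum_family_le n M (univ : Finset (Tor M)) (fun b x => ∑ ay ∈ (univ : Finset (Bool × Bool)).filter
      (fun ay => IsolatedAt M S TT b ay.1 ay.2), pieceW n M (TT, b) ay.1 ay.2 (2 * Ln n + cn n - 1) x)
      (fun μ x => ‖(Pdir (fine n M) (n : ℂ) μ *ᵥ u) x‖ ^ 2) (c := 4 * cWin n M S u) fun b _ => hb b).trans (le_of_eq ?_)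
  rw [Finset.card_univ]

/-! ## §2 The summed binder in field form -/

/-- **THE SUMMED WEIGHTED HESSIAN, FIELD FORM**: for `n ≥ 64`, `M_ν ≥ 2`, `20·2^J + 1 ≤ n − 1`, `q + 6 ≤ 2^{J+4}`, a family `V` of re-entrant
vertices containing all of them, a weight `g` as in `dom_pointwise`, and `u` vanishing off `Ω`:
`Σ_μ Σ_{x∈Ω} g|∂ᴴ_μ∂_μu|² ≤ C_g|V|·(2C_J·E + C′_J·B) + g_max·20|Tor M|·cWin(u)`. [folklore] -/
theorem dom_sum_field (hn : 64 ≤ n) (hM2 : ∀ ν, 2 ≤ M ν) (V : Finset ((Fin 2 → Bool) × Tor M))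
    (hV : ∀ v ∈ V, ReentrantAt M S v.1 v.2) (hVre : ∀ σ b, ReentrantAt M S σ b → (σ, b) ∈ V)
    {J : ℕ} (hJ : (n / 4 : ℕ) + 6 ≤ 2 * 2 ^ (J + 3)) (hJn : 20 * 2 ^ J + 1 ≤ n - 1)
    {ε : ℝ} (hε : 0 < ε) (hγ : 1 < Real.pi / 3 * (1 - ε / 2))
    {g : Tor (fine n M) → ℝ} {Cg gmax : ℝ} (hCg : 0 ≤ Cg) (hg0 : ∀ x, 0 ≤ g x) (hgmax : ∀ x, g x ≤ gmax)
    (hgV : ∀ σ b, (σ, b) ∈ V → ∀ i j : ℤ, ¬ (0 ≤ i ∧ 0 ≤ j) → rho i j ≤ 2 ^ (J + 3) →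
      g (emb n M σ b i j) ≤ Cg * (rho i j : ℝ) / n)
    (hu : ∀ x, ¬ blockReg n M S x → u x = 0) :
    ∑ μ, ∑ x ∈ univ.filter (blockReg n M S), g x * ‖(Pdir (fine n M) (n : ℂ) μ *ᵥ u) x‖ ^ 2
      ≤ Cg * (V.card * (2 * (112 + 10 ^ 9 / (Real.pi / 3 * (1 - ε / 2) - 1)) * En n M u
          + (8 / 5 + 4 * Real.pi * (112 + 10 ^ 9 / (Real.pi / 3 * (1 - ε / 2) - 1)) / (ε * (2 - Real.pi / 3 * (1 - ε / 2)))) * Bn n M S u))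
        + gmax * (20 * Fintype.card (Tor M) * cWin n M S u) := by
  have hM0 := hM2 0
  have hM1 := hM2 1
  set F : Fin 2 → Tor (fine n M) → ℝ := fun μ x => ‖(Pdir (fine n M) (n : ℂ) μ *ᵥ u) x‖ ^ 2 with hF
  have hF0 : ∀ μ x, 0 ≤ F μ x := fun μ x => sq_nonneg _
  have hgmax0 : 0 ≤ gmax := by
    have := hg0 (emb n M TT 0 0 0); have := hgmax (emb n M TT 0 0 0); linarith
  -- pointwise domination, then extend to all sites
  have step1 : ∑ μ, ∑ x ∈ univ.filter (blockReg n M S), g x * F μ x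
      ≤ ∑ μ, ∑ x, (Cg * WH n M V J x + gmax * (WP n M S x + WT n M S x + WI n M S x)) * F μ x := by
    refine sum_le_sum fun μ _ => ?_
    calc ∑ x ∈ univ.filter (blockReg n M S), g x * F μ x
        ≤ ∑ x ∈ univ.filter (blockReg n M S), (Cg * WH n M V J x + gmax * (WP n M S x + WT n M S x + WI n M S x)) * F μ x :=
          sum_le_sum fun x hx => mul_le_mul_of_nonneg_right
            (dom_pointwise n M S hn V hVre hJ hCg hg0 hgmax hgV (mem_filter.mp hx).2) (hF0 μ x)
      _ ≤ ∑ x, (Cg * WH n M V J x + gmax * (WP n M S x + WT n M S x + WI n M S x)) * F μ x :=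
          sum_le_univ_sum_of_nonneg fun x => mul_nonneg (add_nonneg (mul_nonneg hCg (WH_nonneg n M V J x))
            (mul_nonneg hgmax0 (add_nonneg (add_nonneg (WP_nonneg n M S x) (WT_nonneg n M S x)) (WI_nonneg n M S x)))) (hF0 μ x)
  have step2 : ∑ μ, ∑ x, (Cg * WH n M V J x + gmax * (WP n M S x + WT n M S x + WI n M S x)) * F μ x
      = Cg * ∑ μ, ∑ x, WH n M V J x * F μ x
        + gmax * (∑ μ, ∑ x, WP n M S x * F μ x + ∑ μ, ∑ x, WT n M S x * F μ x + ∑ μ, ∑ x, WI n M S x * F μ x) := by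
    simp only [add_mul, mul_add, mul_assoc, sum_add_distrib, mul_sum]
  have hH := sum_WH_le n M S (u := u) V hV hu (by omega) hM0 hM1 hJn hε hγ
  have hP := sum_WP_le n M S (u := u) hu hn hM0 hM1
  have hT := sum_WT_le n M S (u := u) hu hn hM0 hM1
  have hI := sum_WI_le n M S (u := u) hu hn hM0 hM1
  rw [hF] at step1 step2
  refine step1.trans ?_
  rw [step2]
  have hsum : ∑ μ, ∑ x, WP n M S x * ‖(Pdir (fine n M) (n : ℂ) μ *ᵥ u) x‖ ^ 2 + ∑ μ, ∑ x, WT n M S x * ‖(Pdir (fine n M) (n : ℂ) μ *ᵥ u) x‖ ^ 2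
      + ∑ μ, ∑ x, WI n M S x * ‖(Pdir (fine n M) (n : ℂ) μ *ᵥ u) x‖ ^ 2 ≤ 20 * Fintype.card (Tor M) * cWin n M S u := by linarith
  exact add_le_add (mul_le_mul_of_nonneg_left hH hCg) (mul_le_mul_of_nonneg_left hsum hgmax0)

end Field

/-! ## §3 For the Dirichlet solution of any decidable spelling of the block region -/

omit [NeZero n] hM [DecidablePred S] in
/-- `n/L ≤ 128` for `n ≥ 64`. [folklore] -/
theorem nL_le_128 (hn : 64 ≤ n) : (n : ℝ) / Ln n ≤ 128 := by
  have hL : (0 : ℝ) < Ln n := by have := (census_arith n hn).2.2.1; exact_mod_cast this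
  rw [div_le_iff₀ hL]
  have : n ≤ 128 * Ln n := by unfold Ln; omega
  exact_mod_cast this

/-- the unweighted per-window constant `c_U = 4(1+(a′γ′⁻¹)²) + 32·128²·γ′⁻¹ + 16·128⁴·γ′⁻²`. [folklore] -/
def cU (a' : ℝ) : ℝ :=
  4 * (1 + (a' * (gammaPs 2 a')⁻¹) ^ 2) + 32 * 128 ^ 2 * (gammaPs 2 a')⁻¹ + 16 * 128 ^ 4 * ((gammaPs 2 a')⁻¹) ^ 2

/-- **THE CONSTANT OF THE DOMINATED WEIGHTED HESSIAN**: `α_dom = C_g·|V|·α₁ + g_max·20|Tor M|·c_U`. [folklore] -/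
def alphaDom (cardV cardT : ℕ) (Cg gmax ε a' : ℝ) : ℝ := Cg * cardV * alphaV ε a' + gmax * (20 * cardT) * cU a'

variable (a' : ℝ)

/-- **THE SUMMED WEIGHTED HESSIAN OF THE DIRICHLET SOLUTION** for ANY decidable spelling `p` of the block region `blockReg n M S`:
for `u = solExt n M a′ p f`, `Σ_μ Σ_{x∈Ω} g|∂ᴴ_μ∂_μu|² ≤ α_dom·‖f‖²`. [folklore] -/
theorem dom_sum_solExt (hn : 64 ≤ n) (hM2 : ∀ ν, 2 ≤ M ν) (V : Finset ((Fin 2 → Bool) × Tor M))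
    (hV : ∀ v ∈ V, ReentrantAt M S v.1 v.2) (hVre : ∀ σ b, ReentrantAt M S σ b → (σ, b) ∈ V)
    {J : ℕ} (hJ : (n / 4 : ℕ) + 6 ≤ 2 * 2 ^ (J + 3)) (hJn : 20 * 2 ^ J + 1 ≤ n - 1)
    {ε : ℝ} (hε : 0 < ε) (hγ : 1 < Real.pi / 3 * (1 - ε / 2)) (ha' : 0 < a')
    {g : Tor (fine n M) → ℝ} {Cg gmax : ℝ} (hCg : 0 ≤ Cg) (hg0 : ∀ x, 0 ≤ g x) (hgmax : ∀ x, g x ≤ gmax)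
    (hgV : ∀ σ b, (σ, b) ∈ V → ∀ i j : ℤ, ¬ (0 ≤ i ∧ 0 ≤ j) → rho i j ≤ 2 ^ (J + 3) →
      g (emb n M σ b i j) ≤ Cg * (rho i j : ℝ) / n)
    (p : Tor (fine n M) → Prop) [DecidablePred p] (hp : ∀ x, p x ↔ blockReg n M S x) (f : {x // p x} → ℂ) :
    ∑ μ, ∑ x ∈ univ.filter p, g x * ‖(Pdir (fine n M) (n : ℂ) μ *ᵥ solExt n M a' p f) x‖ ^ 2
      ≤ alphaDom V.card (Fintype.card (Tor M)) Cg gmax ε a' * nsq f := by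
  set u := solExt n M a' p f with hu
  have hu0 : ∀ x, ¬ blockReg n M S x → u x = 0 := fun x hx => solExt_apply_of_not n M a' p f (fun h => hx ((hp x).mp h))
  have hfilt : univ.filter p = univ.filter (blockReg n M S) := filter_congr fun x _ => hp x
  rw [hfilt]
  have hγp := (gammaPs_pos (d := 2) (a' := a')).1
  have hπ3 := Real.pi_gt_three
  have hε2 : ε < 2 := by
    by_contra h
    have : Real.pi / 3 * (1 - ε / 2) ≤ 0 := mul_nonpos_of_nonneg_of_nonpos (by positivity) (by linarith)
    linarith
  have hγ1 : 0 < Real.pi / 3 * (1 - ε / 2) - 1 := by linarith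
  have h2γ : 0 < 2 - Real.pi / 3 * (1 - ε / 2) := by
    have h1 : Real.pi / 3 * (1 - ε / 2) ≤ Real.pi / 3 * 1 := mul_le_mul_of_nonneg_left (by linarith) (by positivity)
    linarith [Real.pi_lt_four]
  -- the three budgets
  have hE : En n M u ≤ (gammaPs 2 a')⁻¹ * nsq f := by
    have h := dirichlet_solExt_le n M a' p ha' f
    rw [dirichlet, Fin.sum_univ_two] at h
    exact h
  have hB : Bn n M S u ≤ 2 * (1 + (a' * (gammaPs 2 a')⁻¹) ^ 2) * nsq f := by
    unfold Bn
    rw [Finset.sum_subtype (univ.filter (blockReg n M S)) (p := p) (fun x => by simp [hp x])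
      (fun x => ‖(LapS (fine n M) (n : ℂ) *ᵥ u) x‖ ^ 2)]
    exact sum_normSq_LapS_solExt_le n M a' p ha' f
  have hN : nsq u ≤ ((gammaPs 2 a')⁻¹) ^ 2 * nsq f := nsq_solExt_le n M a' p ha' f
  have hf0 := nsq_nonneg f
  have hE0 := En_nonneg n M u
  have hB0 := Bn_nonneg n M S u
  have hgmax0 : 0 ≤ gmax := by
    have := hg0 (emb n M TT 0 0 0); have := hgmax (emb n M TT 0 0 0); linarith
  -- the window currency
  have hnL := nL_le_128 n hn
  have hnL0 : (0 : ℝ) ≤ (n : ℝ) / Ln n := by positivity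
  have hc : cWin n M S u ≤ cU a' * nsq f := by
    unfold cWin cU
    have h2 : ((n : ℝ) / Ln n) ^ 2 ≤ 128 ^ 2 := pow_le_pow_left₀ hnL0 hnL 2
    have h4 : ((n : ℝ) / Ln n) ^ 4 ≤ 128 ^ 4 := pow_le_pow_left₀ hnL0 hnL 4
    have hN0 := nsq_nonneg u
    have t1 : 32 * ((n : ℝ) / Ln n) ^ 2 * En n M u ≤ 32 * 128 ^ 2 * ((gammaPs 2 a')⁻¹ * nsq f) :=
      mul_le_mul (mul_le_mul_of_nonneg_left h2 (by norm_num)) hE hE0 (by positivity)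
    have t2 : 16 * ((n : ℝ) / Ln n) ^ 4 * nsq u ≤ 16 * 128 ^ 4 * (((gammaPs 2 a')⁻¹) ^ 2 * nsq f) :=
      mul_le_mul (mul_le_mul_of_nonneg_left h4 (by norm_num)) hN hN0 (by positivity)
    nlinarith [hB, t1, t2]
  have hfield := dom_sum_field n M S hn hM2 V hV hVre hJ hJn hε hγ hCg hg0 hgmax hgV hu0
  refine hfield.trans ?_
  have hC : 0 < 112 + 10 ^ 9 / (Real.pi / 3 * (1 - ε / 2) - 1) := by positivity
  have hC' : 0 ≤ 8 / 5 + 4 * Real.pi * (112 + 10 ^ 9 / (Real.pi / 3 * (1 - ε / 2) - 1)) / (ε * (2 - Real.pi / 3 * (1 - ε / 2))) := by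
    positivity
  have hdy : 2 * (112 + 10 ^ 9 / (Real.pi / 3 * (1 - ε / 2) - 1)) * En n M u
      + (8 / 5 + 4 * Real.pi * (112 + 10 ^ 9 / (Real.pi / 3 * (1 - ε / 2) - 1)) / (ε * (2 - Real.pi / 3 * (1 - ε / 2)))) * Bn n M S u
      ≤ alphaV ε a' * nsq f := by
    unfold alphaV
    nlinarith [mul_le_mul_of_nonneg_left hE (le_of_lt (mul_pos two_pos hC)), mul_le_mul_of_nonneg_left hB hC']
  unfold alphaDom
  have hV0 : (0 : ℝ) ≤ V.card := Nat.cast_nonneg _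
  have hT0 : (0 : ℝ) ≤ Fintype.card (Tor M) := Nat.cast_nonneg _
  nlinarith [mul_le_mul_of_nonneg_left hdy (mul_nonneg hCg hV0), mul_le_mul_of_nonneg_left hc (mul_nonneg hgmax0 (by positivity :
    (0 : ℝ) ≤ 20 * Fintype.card (Tor M)))]

end Summit.QuantumFields.BalabanUV.Beta.GAN24.DirichletVertexDomSum

end
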